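import Summits.HodgeConjecture.CorCM.GaloisTwoPowerClassification
import Summits.HodgeConjecture.CorCM.GaloisTwoPowerCyclicNormalSquares
import Summits.HodgeConjecture.CorCM.GaloisDicyclicTimesTwoAllTypes
import Summits.HodgeConjecture.CorCM.AbelianCMFieldsStablyNondegenerate
import Mathlib.GroupTheory.NoncommCoprod
import HarnessLib

/-!
# The Hodge conjecture for all powers of all abelian varieties with CM by a structured `2`-power Galois CM field

COR-CM (cell `pub-hodgecm2`), binder seat b04 (gen 35), count-neutral own lane «Galois-CM-type classification».  KERNEL ONLY:
theorems; no definition, no named fact, no `sorry`.  `HC_CM` is neither used nor claimed.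

STRUCT(`K`): `Gal(K/ℚ) = H·E` with `H.IsComplement' E`, `E` central of exponent `2`, `|E| ≤ 2`, complex conjugation `c ∈ H`,
`|H| = 2^k`, `H` cyclic or `≃ QuaternionGroup (2^(k-2))` — i.e. `Gal(K/ℚ)` is `C_{2^n}`, `Q_{2^n}`, `C_{2^(n-1)} × C₂` (`c ∈ C`) or
`Q_{2^(n-1)} × C₂` (`c ∈ Q`).  For each of the four rows the tree already holds the Hodge conjecture for EVERY POWER OF EVERY abelian
variety with CM by `K` (any CM type, primitive or not — non-primitive types are stably nondegenerate): `C`, `Q` — every CM type is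
nondegenerate (gens 11/20, `IsNondegenerate.hodgeConjectureFor_pow`); `C × C₂` — GOOD abelian fields
(`AbelianAllTypes.hodgeConjectureFor_pow_of_good_abelian`, gen 21); `Q × C₂` — `GaloisDicyclic.hodgeConjectureFor_pow_quaternion_times_two`
(gen 30).  HERE they are packaged behind STRUCT and combined with the session's classification:

* **`hodgeConjectureFor_pow_of_struct`** — STRUCT ⟹ HC for `⨁_{Fin N} A` for every abelian variety `A` realising any CM type of `K`.
* **`hodgeConjectureFor_pow_of_orderOf_eq_half`** — UNCONDITIONAL: `K` Galois CM of degree `2^n ≥ 64`, every primitive CM type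
  nondegenerate, with an automorphism of order `2^(n-1)` ⟹ HC for all powers of all abelian varieties with CM by `K`
  (`CorCM/GaloisTwoPowerCyclicNormalSquares`).
* **`hodgeConjectureFor_pow_of_degree_thirtytwo`** — modulo the degree-`32` base of `CorCM/GaloisTwoPowerClassification`: for EVERY
  Galois CM field of degree `2^n ≥ 32` all of whose primitive CM types are nondegenerate, HC holds for all powers of all abelian
  varieties with CM by `K` (GOOD ⟹ STRUCT ⟹ stably nondegenerate).

## References

* [Gordon1999HodgeAVSurvey] B. B. Gordon, *A survey of the Hodge conjecture for abelian varieties*, Thm. 6.4, §9.3, §9.4.3.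
* [Shimura1998] G. Shimura, *Abelian Varieties with Complex Multiplication and Modular Functions*, §5.1 Prop. 3, §8.2 Prop. 26.
* [Kubota1965] T. Kubota, *On the field extension by complex multiplication*, Trans. AMS 118 (1965), §2 and §4 Lemma 2.
* [Rotman1995] J. J. Rotman, *An Introduction to the Theory of Groups*, 4th ed., GTM 148, Springer 1995, Thm. 5.46.
-/

noncomputable section

open CategoryTheory CategoryTheory.Limits NumberField
open scoped BigOperators

namespace Summit.HodgeConjecture.CorCM.GaloisModels

open Literature.NumberTheory.ComplexMultiplication
open Literature.AlgebraicGeometry.Motives (AbelianVariety CMType)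
open Literature.AlgebraicGeometry.HodgeTheory
open Literature.AlgebraicGeometry.ComplexMultiplication (IsCMTypeRealisation)
open Literature.AlgebraicGeometry.Pohlmann1968
open Summit.HodgeConjecture.CorCM.GaloisRank

variable {K : Type} [Field K] [NumberField K] [IsCMField K] [IsGalois ℚ K]

/-- **STRUCT ⟹ THE HODGE CONJECTURE FOR EVERY POWER OF EVERY ABELIAN VARIETY WITH CM BY `K`.**  `K` Galois CM of degree `2^n`,
`n ≥ 1`; `Gal(K/ℚ) = H·E` with `H.IsComplement' E`, `E` central of exponent `2`, `|E| ≤ 2`, `c ∈ H`, `|H| = 2^k`, `H` cyclic or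
`≃ QuaternionGroup (2^(k-2))`; `A` any abelian variety realising ANY CM type `Φ` of `K`.  Then `HC(⨁_{Fin N} A)` for all `N` — the
rows `C_{2^n}` (gen 11), `Q_{2^n}` (gen 20), `C_{2^(n-1)} × C₂` (gen 21) and `Q_{2^(n-1)} × C₂` (gen 30) of the classification.
[cite: Gordon1999HodgeAVSurvey, Thm. 6.4, §9.3 and §9.4.3] [cite: Shimura1998, §5.1 Prop. 3 and §8.2 Prop. 26] -/
theorem hodgeConjectureFor_pow_of_struct {n : ℕ} (hdeg : Module.finrank ℚ K = 2 ^ n) (hn : 1 ≤ n)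
    (H E : Subgroup (K ≃ₐ[ℚ] K)) (k : ℕ) (hHE : H.IsComplement' E) (hcH : (IsCMField.complexConj K).restrictScalars ℚ ∈ H)
    (hE : ∀ e ∈ E, e * e = 1 ∧ ∀ g : K ≃ₐ[ℚ] K, g * e = e * g) (hEcard : Nat.card E ≤ 2) (hHcard : Nat.card H = 2 ^ k)
    (hstruct : IsCyclic H ∨ (3 ≤ k ∧ Nonempty (H ≃* QuaternionGroup (2 ^ (k - 2)))))
    {Φ : CMType K} {A : AbelianVariety ℂ} {ι : 𝓞 K →+* End A} {θ : K →+* Module.End ℂ (complexBetti A.X 1)}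
    (hA : IsCMTypeRealisation Φ A ι θ) (N : ℕ) :
    HodgeConjectureFor (⨁ fun _ : Fin N => A).dim (⨁ fun _ : Fin N => A).X := by
  classical
  set c := (IsCMField.complexConj K).restrictScalars ℚ with hc
  have hcc : c * c = 1 := model_complexConj_mul_self (MulEquiv.refl (K ≃ₐ[ℚ] K)) (by simp [hc])
  have hc1 : c ≠ 1 := model_complexConj_ne_one (MulEquiv.refl (K ≃ₐ[ℚ] K)) (by simp [hc])
  have hcard : Nat.card (K ≃ₐ[ℚ] K) = 2 ^ n := by
    rw [Nat.card_eq_fintype_card, card_model_eq_finrank (MulEquiv.refl (K ≃ₐ[ℚ] K)), hdeg]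
  have hcen : ∀ e ∈ E, ∀ g : K ≃ₐ[ℚ] K, g * e = e * g := fun e he => (hE e he).2
  have hHEcard : Nat.card H * Nat.card E = 2 ^ n := by rw [hHE.card_mul, hcard]
  have hdecomp : ∀ g : K ≃ₐ[ℚ] K, ∃ h ∈ H, ∃ e ∈ E, h * e = g := fun g => by
    obtain ⟨⟨h, e⟩, rfl⟩ := hHE.2 g
    exact ⟨h, h.2, e, e.2, rfl⟩
  have hEpos : 0 < Nat.card E := Nat.card_pos
  by_cases hE1 : Nat.card E = 1
  · /- `E = 1`: every CM type of `K` is nondegenerate -/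
    have hHtop : H = ⊤ := by
      rw [← Subgroup.card_eq_iff_eq_top, hcard, ← hHEcard, hE1, mul_one]
    have hkn : k = n := Nat.pow_right_injective le_rfl (show 2 ^ k = 2 ^ n by rw [← hHcard, ← hHEcard, hE1, mul_one])
    let e₀ : (K ≃ₐ[ℚ] K) ≃* H := (Subgroup.topEquiv.symm.trans (MulEquiv.subgroupCongr hHtop.symm))
    have hCQ : IsCyclic (K ≃ₐ[ℚ] K) ∨ Nonempty ((K ≃ₐ[ℚ] K) ≃* QuaternionGroup (2 ^ (n - 2))) := by
      rcases hstruct with hcyc | ⟨-, ⟨f⟩⟩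
      · exact Or.inl (isCyclic_of_surjective e₀.symm e₀.symm.surjective)
      · rw [hkn] at f
        exact Or.inr ⟨e₀.trans f⟩
    exact (isNondegenerate_of_isCyclic_or_quaternion hdeg hn hCQ Φ).hodgeConjectureFor_pow hA N
  · /- `|E| = 2` -/
    have hE2 : Nat.card E = 2 := by omega
    have hn2 : 2 ≤ n := by
      by_contra h
      have hn1 : n = 1 := by omega
      rw [hn1, pow_one, hE2] at hHEcard
      have hH1 : Nat.card H = 1 := by omega
      haveI := (Nat.card_eq_one_iff_unique.mp hH1).1
      exact hc1 (congrArg Subtype.val (Subsingleton.elim (⟨c, hcH⟩ : H) 1))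
    have hHcard' : Nat.card H = 2 ^ (n - 1) := by
      have : Nat.card H * 2 = 2 ^ (n - 1) * 2 := by
        rw [← pow_succ, Nat.sub_add_cancel (by omega : 1 ≤ n), ← hHEcard, hE2]
      exact Nat.eq_of_mul_eq_mul_right (by norm_num) this
    have hHidx : H.index = 2 := by
      have h1 := H.index_mul_card
      rw [hHcard', hcard, show 2 ^ n = 2 * 2 ^ (n - 1) by rw [← pow_succ', Nat.sub_add_cancel (by omega)]] at h1
      exact Nat.eq_of_mul_eq_mul_right (by positivity) h1
    rcases hstruct with hcyc | ⟨hk3, ⟨f⟩⟩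
    · /- `H` cyclic: `K` is a GOOD abelian CM field (condition (α)) -/
      letI := IsCyclic.commGroup (α := H)
      have hcommH : ∀ h₁ ∈ H, ∀ h₂ ∈ H, h₁ * h₂ = h₂ * h₁ := fun h₁ hh₁ h₂ hh₂ => by
        have := mul_comm (⟨h₁, hh₁⟩ : H) ⟨h₂, hh₂⟩
        exact congrArg Subtype.val this
      have hcomm : ∀ g₁ g₂ : K ≃ₐ[ℚ] K, g₁ * g₂ = g₂ * g₁ := by
        intro g₁ g₂
        obtain ⟨h₁, hh₁, e₁, he₁, rfl⟩ := hdecomp g₁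
        obtain ⟨h₂, hh₂, e₂, he₂, rfl⟩ := hdecomp g₂
        rw [show h₁ * e₁ * (h₂ * e₂) = (h₁ * h₂) * (e₁ * e₂) by
            rw [mul_assoc, ← mul_assoc e₁, ← hcen e₁ he₁ h₂]; group,
          show h₂ * e₂ * (h₁ * e₁) = (h₂ * h₁) * (e₂ * e₁) by
            rw [mul_assoc, ← mul_assoc e₂, ← hcen e₂ he₂ h₁]; group,
          hcommH h₁ hh₁ h₂ hh₂, hcen e₁ he₁ e₂]
      obtain ⟨gH, hgH⟩ := IsCyclic.exists_generator (α := H)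
      have hHz : H = Subgroup.zpowers (gH : K ≃ₐ[ℚ] K) := by
        apply le_antisymm
        · intro s hs
          obtain ⟨i, hi⟩ := Subgroup.mem_zpowers_iff.1 (hgH ⟨s, hs⟩)
          exact Subgroup.mem_zpowers_iff.2 ⟨i, by rw [← Subgroup.coe_zpow, hi]⟩
        · exact Subgroup.zpowers_le.2 gH.2
      refine AbelianAllTypes.hodgeConjectureFor_pow_of_good_abelian hcomm (a := n - 1) (m := 1) odd_one
        (by rw [hdeg, Nat.sub_add_cancel (by omega), mul_one]) (Or.inl ⟨rfl, Or.inl ⟨gH, ?_, ?_⟩⟩) hA N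
      · rw [← hHz]; exact hcH
      · rw [← hHz, hHidx]
    · /- `H` quaternion: `Gal(K/ℚ) ≃ Q × C₂` with `c ↦ (a_m, 1)` -/
      set m := 2 ^ (k - 2) with hm
      haveI : NeZero m := ⟨by positivity⟩
      have hcommHE : ∀ (h : H) (e : E), Commute (H.subtype h) (E.subtype e) := fun h e =>
        show (h : K ≃ₐ[ℚ] K) * e = e * h from hcen e e.2 h
      let ψ₀ : H × E →* (K ≃ₐ[ℚ] K) := MonoidHom.noncommCoprod H.subtype E.subtype hcommHE
      have hψ₀ : Function.Bijective ψ₀ := by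
        have : (ψ₀ : H × E → (K ≃ₐ[ℚ] K)) = fun x => x.1.1 * x.2.1 := by
          funext x
          rfl
        rw [this]
        exact hHE
      let ψ : H × E ≃* (K ≃ₐ[ℚ] K) := MulEquiv.ofBijective ψ₀ hψ₀
      haveI : Fact (Nat.Prime 2) := ⟨Nat.prime_two⟩
      have hZ2 : Nat.card (Multiplicative (ZMod 2)) = 2 := by simp
      let g : E ≃* Multiplicative (ZMod 2) := mulEquivOfPrimeCardEq hE2 hZ2
      let e : (K ≃ₐ[ℚ] K) ≃* QuaternionGroup m × Multiplicative (ZMod 2) := ψ.symm.trans (f.prodCongr g)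
      have hψc : ψ (⟨c, hcH⟩, 1) = c := by
        show ψ₀ (⟨c, hcH⟩, 1) = c
        rw [MonoidHom.noncommCoprod_apply]
        simp
      have hec : e c = (QuaternionGroup.a m, 1) := by
        have h1 : ψ.symm c = (⟨c, hcH⟩, 1) := by rw [MulEquiv.symm_apply_eq]; exact hψc.symm
        have h2 : e c = (f ⟨c, hcH⟩, g 1) := by
          show (f.prodCongr g) (ψ.symm c) = _
          rw [h1]
          rfl
        rw [h2, map_one]
        congr 1
        refine GaloisDicyclic.eq_a_of_mul_self_eq_one _ ?_ ?_
        · rw [← map_mul, ← map_one f]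
          congr 1
          exact Subtype.ext hcc
        · intro h
          exact hc1 (congrArg Subtype.val (f.injective (h.trans (map_one f).symm)))
      exact GaloisDicyclic.hodgeConjectureFor_pow_quaternion_times_two (n := m) (k := k - 2) hm e hec hA N

/-- **UNCONDITIONAL: an automorphism of order `[K:ℚ]/2` in a GOOD Galois CM field of degree `2^n ≥ 64` ⟹ the Hodge conjecture for
every power of every abelian variety with CM by `K`** (any CM type).  (`CorCM/GaloisTwoPowerCyclicNormalSquares` structures
`Gal(K/ℚ)`; then `hodgeConjectureFor_pow_of_struct`.) [cite: Gordon1999HodgeAVSurvey, Thm. 6.4, §9.3 and §9.4.3]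
[cite: Shimura1998, §5.1 Prop. 3 and §8.2 Prop. 26] [cite: Rotman1995, Thm. 5.46] -/
theorem hodgeConjectureFor_pow_of_orderOf_eq_half {n : ℕ} (hdeg : Module.finrank ℚ K = 2 ^ n) (hn : 6 ≤ n)
    (hgood : ∀ (Φ : CMType K) (φ : K →+* ℂ), IsPrimitive (ℂ ≃+* ℂ) Φ.1 φ → IsNondegenerate Φ) (a : K ≃ₐ[ℚ] K)
    (ha : orderOf a = 2 ^ (n - 1))
    {Φ : CMType K} {A : AbelianVariety ℂ} {ι : 𝓞 K →+* End A} {θ : K →+* Module.End ℂ (complexBetti A.X 1)}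
    (hA : IsCMTypeRealisation Φ A ι θ) (N : ℕ) :
    HodgeConjectureFor (⨁ fun _ : Fin N => A).dim (⨁ fun _ : Fin N => A).X := by
  obtain ⟨H, E, k, hHE, hcH, -, hE, hEcard, hHcard, hstruct⟩ := struct_of_orderOf_eq_half hdeg hn hgood a ha
  exact hodgeConjectureFor_pow_of_struct hdeg (by omega) H E k hHE hcH hE hEcard hHcard hstruct hA N

/-- **MODULO THE DEGREE-`32` BASE: the Hodge conjecture for every power of every abelian variety with CM by ANY GOOD Galois CM field of
`2`-power degree `≥ 32`.**  If every GOOD Galois CM field of degree `32` is structured (the order-`32` census), then for every Galois CM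
field `K` of degree `2^n`, `n ≥ 5`, all of whose primitive CM types are nondegenerate, and every abelian variety `A` realising any CM
type of `K`: `HC(⨁_{Fin N} A)`. [cite: Gordon1999HodgeAVSurvey, Thm. 6.4, §9.3 and §9.4.3] [cite: Shimura1998, §5.1 Prop. 3 and §8.2 Prop. 26]
[cite: Rotman1995, Thm. 5.46] -/
theorem hodgeConjectureFor_pow_of_degree_thirtytwo
    (h32 : ∀ (K : Type) [Field K] [NumberField K] [IsCMField K] [IsGalois ℚ K],
      Module.finrank ℚ K = 32 →
      (∀ (Φ : CMType K) (φ : K →+* ℂ), IsPrimitive (ℂ ≃+* ℂ) Φ.1 φ → IsNondegenerate Φ) →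
      ∃ (H E : Subgroup (K ≃ₐ[ℚ] K)) (k : ℕ), H.IsComplement' E ∧ (IsCMField.complexConj K).restrictScalars ℚ ∈ H ∧
        (IsCMField.complexConj K).restrictScalars ℚ ∉ E ∧ (∀ e ∈ E, e * e = 1 ∧ ∀ g : K ≃ₐ[ℚ] K, g * e = e * g) ∧
        Nat.card E ≤ 2 ∧ Nat.card H = 2 ^ k ∧ (IsCyclic H ∨ (3 ≤ k ∧ Nonempty (H ≃* QuaternionGroup (2 ^ (k - 2))))))
    {n : ℕ} (hdeg : Module.finrank ℚ K = 2 ^ n) (hn : 5 ≤ n)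
    (hgood : ∀ (Φ : CMType K) (φ : K →+* ℂ), IsPrimitive (ℂ ≃+* ℂ) Φ.1 φ → IsNondegenerate Φ)
    {Φ : CMType K} {A : AbelianVariety ℂ} {ι : 𝓞 K →+* End A} {θ : K →+* Module.End ℂ (complexBetti A.X 1)}
    (hA : IsCMTypeRealisation Φ A ι θ) (N : ℕ) :
    HodgeConjectureFor (⨁ fun _ : Fin N => A).dim (⨁ fun _ : Fin N => A).X := by
  obtain ⟨H, E, k, hHE, hcH, -, hE, hEcard, hHcard, hstruct⟩ := struct_of_degree_thirtytwo h32 hdeg hn hgood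
  exact hodgeConjectureFor_pow_of_struct hdeg (by omega) H E k hHE hcH hE hEcard hHcard hstruct hA N

end Summit.HodgeConjecture.CorCM.GaloisModels
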